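import Literature.NumberTheory.Automorphic.ArchPiMeasureInsert                -- ★ (R3-f) step 2a: Fubini at one coordinate; brings ★ `isFiniteMeasureOnCompacts_map_conj_circleDiagonal` (N-general)
import Literature.NumberTheory.Automorphic.ArchLocalRegularOrbitClosed           -- ★ `locallyCompactSpace_archLocal`, `secondCountableTopology_archLocal`
import Mathlib.Analysis.SpecialFunctions.Complex.Circle
import HarnessLib

/-!
# The measure family `M(S, u, σ)` of the RANK-2 descent over places for (S-d): orbit measures of `diag(u_w ∘ σ_w)` at the live places `w ∈ S`, Dirac masses at the centre `ζ_w•1`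
# off `S` — Radon, σ-finite, and its updates at one place (port of ★ `ArchEndoscopicCentralDescent` §1 to `N = 3` with `S₃`-labels; Rogawski 1990 §8.4 p. 127, §14.5 p. 239)

Topic `NumberTheory/Automorphic`; namespace `Literature.NumberTheory.Automorphic.UnitaryGroup`.  THEOREMS ONLY (no `def`, no instance, no notation, no axiom, no named fact, no `sorry`).
Cell `pub/hodgecm-mathlib`, ENGINE T1 (crux H413 = `stmt-HodgeConjecture-24833`); ROAD-Sd residual R4 (`stub_SdCanonical` of `Cruxes/H413/Lines/F0_P3a_SdArch.lean`), SdArch ED. 3 node N5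
«E2-central», FILE A §1 of F0P3a-p03 (g11)'s census `CENSUS-N5-ArchCentralDescentRankTwo` (783c9612) — the CO-HAND PIECE, cut by F0P3a-p06 (g11) as a separate module that FILE A imports.

THE DATA (no definitions — everything is a lambda in the statements; tokens = census §1 VERBATIM).  `W` = the complex places, `G_w = archLocal L 3 (diagonal α) w` (`α_i ≠ 0`), local Haar measures
`νw w`, the centre `z : W → S¹` (the place-`w` image `ζ_w•1 = diag(z_w, z_w, z_w)` of the rational central element), torus data `u : W → Fin 3 → S¹` and LABELS `σ : W → Equiv.Perm (Fin 3)` (all six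
relabellings per place; class multiplicities are constants absorbed downstream).  For a finite set `S` of places the MEASURE FAMILY
  `M(S, u, σ)_w := if w ∈ S then conj(diag(u_w ∘ σ_w))_* (νw w) else δ_{diag(z_w, z_w, z_w)}`,
and the MIXED INTEGRAL of FILE A is `I(S, u) = Σ_σ ∫ Θ ↑↑e⁻¹(o) d(⊗_w M(S, u, σ)_w)(o)`.

WHAT IS PROVED (statements byte-parallel to ★ p841432 §1 with `2 ↦ 3`, flips `ε` ↦ labels `σ`, `![z w, z w] ↦ fun _ => z w`).
* `injective_comp_perm` — `u ∘ σ` is injective when `u` is.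
* `isFiniteMeasureOnCompacts_measureFamily₃`, `sigmaFinite_measureFamily₃` — Radon and σ-finite at every place when `u` is regular (injective) on `S` (★ `isFiniteMeasureOnCompacts_map_conj_circleDiagonal`).
* `measureFamily₃_update_eq_update` — moving `u` at `w₁ ∈ S` = updating the family of `S ∖ w₁` at `w₁` by the orbit measure of the new (relabelled) point.
* `measureFamily₃_eq_update_dirac` — for `w₁ ∉ S` the family IS its own update at `w₁` by the Dirac mass at the centre.
* `continuous_hasCompactSupport_comp_archPiEquivCM_symm₃` — the test function `o ↦ Θ ↑↑e⁻¹(o)` on `∏_w G_w` is continuous with compact support.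
HONEST LABEL: HC_CM is proved only modulo the printed citations until rung 0 closes; this file is measure bookkeeping and pays nothing by itself.

## References
* [Rogawski1990] J. D. Rogawski, *Automorphic Representations of Unitary Groups in Three Variables*, Ann. of Math. Stud. 123 (1990), §8.4 p. 127, §14.5 p. 239, §8.3 p. 122.
* [BorelJacquet1979] A. Borel, H. Jacquet, *Automorphic forms and automorphic representations*, PSPM 33.1 (1979), §4.1.
-/

set_option autoImplicit false

noncomputable section

open MeasureTheory Matrix NumberField NumberField.InfinitePlace NumberField.mixedEmbedding Set Function Filter Topology
open scoped MatrixGroups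

namespace Literature.NumberTheory.Automorphic.UnitaryGroup

/-! ## §0 Labels -/

section Small

/-- A relabelled regular point is regular: `u ∘ σ` is injective when `u` is. [cite: Rogawski1990, §8.4 p. 127] -/
theorem injective_comp_perm {β : Type*} {u : Fin 3 → β} (hu : Function.Injective u) (σ : Equiv.Perm (Fin 3)) : Function.Injective (u ∘ σ) :=
  hu.comp σ.injective

end Small

/-! ## §1 The measure family `M(S, u, σ)`: Radon, σ-finite, and its updates at one place -/

section Family

variable (L : Type) [Field L] [NumberField L] [IsCMField L] (α : Fin 3 → L)
  [∀ w : {w : InfinitePlace L // IsComplex w}, MeasurableSpace (archLocal L 3 (Matrix.diagonal α) w)]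
  [∀ w : {w : InfinitePlace L // IsComplex w}, BorelSpace (archLocal L 3 (Matrix.diagonal α) w)]
  (νw : ∀ w : {w : InfinitePlace L // IsComplex w}, Measure (archLocal L 3 (Matrix.diagonal α) w)) [∀ w, (νw w).IsHaarMeasure]
  (z : {w : InfinitePlace L // IsComplex w} → Circle)

omit [NumberField L] [IsCMField L] in
open scoped Classical in
/-- `M(S, u, σ)` is Radon at every place when `u` is regular on `S` (orbit measures at regular points ★ `isFiniteMeasureOnCompacts_map_conj_circleDiagonal`; Dirac masses).
[cite: Rogawski1990, §8.3 p. 122] -/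
theorem isFiniteMeasureOnCompacts_measureFamily₃ (hα : ∀ i, α i ≠ 0) (S : Finset {w : InfinitePlace L // IsComplex w}) (u : {w : InfinitePlace L // IsComplex w} → Fin 3 → Circle)
    (hu : ∀ w ∈ S, Function.Injective (u w)) (σ : {w : InfinitePlace L // IsComplex w} → Equiv.Perm (Fin 3)) (w : {w : InfinitePlace L // IsComplex w}) :
    IsFiniteMeasureOnCompacts ((fun w : {w : InfinitePlace L // IsComplex w} =>
          if w ∈ S then (νw w).map (fun g : archLocal L 3 (Matrix.diagonal α) w =>
            g * ⟨circleDiagonal 3 (u w ∘ ⇑(σ w)), circleDiagonal_mem_archLocal_diagonal L 3 α w _⟩ * g⁻¹)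
          else Measure.dirac (⟨circleDiagonal 3 (fun _ => z w), circleDiagonal_mem_archLocal_diagonal L 3 α w _⟩ : archLocal L 3 (Matrix.diagonal α) w)) w) := by
  simp only []
  split_ifs with hw
  · exact isFiniteMeasureOnCompacts_map_conj_circleDiagonal L 3 α w hα _ (injective_comp_perm (hu w hw) (σ w)) (νw w)
  · infer_instance

omit [NumberField L] [IsCMField L] in
open scoped Classical in
/-- `M(S, u, σ)` is σ-finite at every place when `u` is regular on `S`. [cite: Rogawski1990, §8.3 p. 122] -/
theorem sigmaFinite_measureFamily₃ (hα : ∀ i, α i ≠ 0) (S : Finset {w : InfinitePlace L // IsComplex w}) (u : {w : InfinitePlace L // IsComplex w} → Fin 3 → Circle)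
    (hu : ∀ w ∈ S, Function.Injective (u w)) (σ : {w : InfinitePlace L // IsComplex w} → Equiv.Perm (Fin 3)) (w : {w : InfinitePlace L // IsComplex w}) :
    SigmaFinite ((fun w : {w : InfinitePlace L // IsComplex w} =>
          if w ∈ S then (νw w).map (fun g : archLocal L 3 (Matrix.diagonal α) w =>
            g * ⟨circleDiagonal 3 (u w ∘ ⇑(σ w)), circleDiagonal_mem_archLocal_diagonal L 3 α w _⟩ * g⁻¹)
          else Measure.dirac (⟨circleDiagonal 3 (fun _ => z w), circleDiagonal_mem_archLocal_diagonal L 3 α w _⟩ : archLocal L 3 (Matrix.diagonal α) w)) w) := by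
  haveI : LocallyCompactSpace (archLocal L 3 (Matrix.diagonal α) w) := locallyCompactSpace_archLocal L 3 (Matrix.diagonal α) w
  haveI : SecondCountableTopology (archLocal L 3 (Matrix.diagonal α) w) := secondCountableTopology_archLocal L 3 (Matrix.diagonal α) w
  haveI := isFiniteMeasureOnCompacts_measureFamily₃ L α νw z hα S u hu σ w
  infer_instance

omit [NumberField L] [IsCMField L] [∀ w : {w : InfinitePlace L // IsComplex w}, BorelSpace (archLocal L 3 (Matrix.diagonal α) w)] [∀ w, (νw w).IsHaarMeasure] in
open scoped Classical in
/-- **Moving `u` at `w₁ ∈ S` updates the family at `w₁` by the orbit measure** of the new (relabelled) point, the other places unchanged and equal to those of `S ∖ w₁`.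
[cite: Rogawski1990, §14.5 p. 239] -/
theorem measureFamily₃_update_eq_update (S : Finset {w : InfinitePlace L // IsComplex w}) (w₁ : {w : InfinitePlace L // IsComplex w}) (hw₁ : w₁ ∈ S)
    (u : {w : InfinitePlace L // IsComplex w} → Fin 3 → Circle) (v : Fin 3 → Circle) (σ : {w : InfinitePlace L // IsComplex w} → Equiv.Perm (Fin 3)) :
    (fun w : {w : InfinitePlace L // IsComplex w} =>
          if w ∈ S then (νw w).map (fun g : archLocal L 3 (Matrix.diagonal α) w =>
            g * ⟨circleDiagonal 3 ((Function.update u w₁ v) w ∘ ⇑(σ w)), circleDiagonal_mem_archLocal_diagonal L 3 α w _⟩ * g⁻¹)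
          else Measure.dirac (⟨circleDiagonal 3 (fun _ => z w), circleDiagonal_mem_archLocal_diagonal L 3 α w _⟩ : archLocal L 3 (Matrix.diagonal α) w)) =
      Function.update (fun w : {w : InfinitePlace L // IsComplex w} =>
          if w ∈ (S.erase w₁) then (νw w).map (fun g : archLocal L 3 (Matrix.diagonal α) w =>
            g * ⟨circleDiagonal 3 (u w ∘ ⇑(σ w)), circleDiagonal_mem_archLocal_diagonal L 3 α w _⟩ * g⁻¹)
          else Measure.dirac (⟨circleDiagonal 3 (fun _ => z w), circleDiagonal_mem_archLocal_diagonal L 3 α w _⟩ : archLocal L 3 (Matrix.diagonal α) w)) w₁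
        ((νw w₁).map (fun g : archLocal L 3 (Matrix.diagonal α) w₁ =>
          g * ⟨circleDiagonal 3 (v ∘ ⇑(σ w₁)), circleDiagonal_mem_archLocal_diagonal L 3 α w₁ _⟩ * g⁻¹)) := by
  funext w
  by_cases h : w = w₁
  · subst h
    rw [Function.update_self]
    simp only [hw₁, ↓reduceIte, Function.update_self]
  · rw [Function.update_of_ne h]
    simp only [Finset.mem_erase, ne_eq, h, not_false_eq_true, true_and, Function.update_of_ne h]

omit [NumberField L] [IsCMField L] [∀ w : {w : InfinitePlace L // IsComplex w}, BorelSpace (archLocal L 3 (Matrix.diagonal α) w)] [∀ w, (νw w).IsHaarMeasure] in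
open scoped Classical in
/-- **Off `S` the family IS its update by the Dirac mass**: for `w₁ ∉ S`, `M(S,u,σ) = M(S,u,σ)[w₁ ↦ δ_{diag(z,z,z)}]`. [cite: Rogawski1990, §14.5 p. 239] -/
theorem measureFamily₃_eq_update_dirac (S : Finset {w : InfinitePlace L // IsComplex w}) (w₁ : {w : InfinitePlace L // IsComplex w}) (hw₁ : w₁ ∉ S)
    (u : {w : InfinitePlace L // IsComplex w} → Fin 3 → Circle) (σ : {w : InfinitePlace L // IsComplex w} → Equiv.Perm (Fin 3)) :
    (fun w : {w : InfinitePlace L // IsComplex w} =>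
          if w ∈ S then (νw w).map (fun g : archLocal L 3 (Matrix.diagonal α) w =>
            g * ⟨circleDiagonal 3 (u w ∘ ⇑(σ w)), circleDiagonal_mem_archLocal_diagonal L 3 α w _⟩ * g⁻¹)
          else Measure.dirac (⟨circleDiagonal 3 (fun _ => z w), circleDiagonal_mem_archLocal_diagonal L 3 α w _⟩ : archLocal L 3 (Matrix.diagonal α) w)) =
      Function.update (fun w : {w : InfinitePlace L // IsComplex w} =>
          if w ∈ S then (νw w).map (fun g : archLocal L 3 (Matrix.diagonal α) w =>
            g * ⟨circleDiagonal 3 (u w ∘ ⇑(σ w)), circleDiagonal_mem_archLocal_diagonal L 3 α w _⟩ * g⁻¹)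
          else Measure.dirac (⟨circleDiagonal 3 (fun _ => z w), circleDiagonal_mem_archLocal_diagonal L 3 α w _⟩ : archLocal L 3 (Matrix.diagonal α) w)) w₁
        (Measure.dirac (⟨circleDiagonal 3 (fun _ => z w₁), circleDiagonal_mem_archLocal_diagonal L 3 α w₁ _⟩ : archLocal L 3 (Matrix.diagonal α) w₁)) := by
  have h : (fun w : {w : InfinitePlace L // IsComplex w} =>
          if w ∈ S then (νw w).map (fun g : archLocal L 3 (Matrix.diagonal α) w =>
            g * ⟨circleDiagonal 3 (u w ∘ ⇑(σ w)), circleDiagonal_mem_archLocal_diagonal L 3 α w _⟩ * g⁻¹)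
          else Measure.dirac (⟨circleDiagonal 3 (fun _ => z w), circleDiagonal_mem_archLocal_diagonal L 3 α w _⟩ : archLocal L 3 (Matrix.diagonal α) w)) w₁ =
      Measure.dirac (⟨circleDiagonal 3 (fun _ => z w₁), circleDiagonal_mem_archLocal_diagonal L 3 α w₁ _⟩ : archLocal L 3 (Matrix.diagonal α) w₁) := by
    simp only [hw₁, ↓reduceIte]
  conv_rhs => rw [← h]
  rw [Function.update_eq_self]

omit [∀ w : {w : InfinitePlace L // IsComplex w}, MeasurableSpace (archLocal L 3 (Matrix.diagonal α) w)]
  [∀ w : {w : InfinitePlace L // IsComplex w}, BorelSpace (archLocal L 3 (Matrix.diagonal α) w)] [∀ w, (νw w).IsHaarMeasure] in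
/-- The test function of the descent, `o ↦ Θ ↑↑e⁻¹(o)` on `∏_w G_w`, is continuous with compact support (hence integrable against any Radon σ-finite product and strongly measurable).
[cite: BorelJacquet1979, §4.1] -/
theorem continuous_hasCompactSupport_comp_archPiEquivCM_symm₃ {E : Type*} [NormedAddCommGroup E]
    (Θ : Matrix (Fin 3) (Fin 3) (mixedSpace L) → E) (hΘ : Continuous Θ)
    (hΘc : HasCompactSupport (fun g : arch (↥(maximalRealSubfield L)) L (IsCMField.complexConj L) 3 (Matrix.diagonal α) =>
      Θ ((g : GL (Fin 3) (mixedSpace L)) : Matrix (Fin 3) (Fin 3) (mixedSpace L)))) :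
    Continuous (fun o : (∀ w : {w : InfinitePlace L // IsComplex w}, archLocal L 3 (Matrix.diagonal α) w) => Θ ((((archPiEquivCM 3 L (Matrix.diagonal α)).symm o : arch (↥(maximalRealSubfield L)) L (IsCMField.complexConj L) 3 (Matrix.diagonal α)) : GL (Fin 3) (mixedSpace L)) : Matrix (Fin 3) (Fin 3) (mixedSpace L))) ∧
      HasCompactSupport (fun o : (∀ w : {w : InfinitePlace L // IsComplex w}, archLocal L 3 (Matrix.diagonal α) w) => Θ ((((archPiEquivCM 3 L (Matrix.diagonal α)).symm o : arch (↥(maximalRealSubfield L)) L (IsCMField.complexConj L) 3 (Matrix.diagonal α)) : GL (Fin 3) (mixedSpace L)) : Matrix (Fin 3) (Fin 3) (mixedSpace L))) := by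
  have hι : Continuous fun g : arch (↥(maximalRealSubfield L)) L (IsCMField.complexConj L) 3 (Matrix.diagonal α) =>
      ((g : GL (Fin 3) (mixedSpace L)) : Matrix (Fin 3) (Fin 3) (mixedSpace L)) := Units.continuous_val.comp continuous_subtype_val
  refine ⟨(hΘ.comp hι).comp (archPiEquivCM 3 L (Matrix.diagonal α)).symm.continuous, ?_⟩
  exact hΘc.comp_homeomorph (archPiEquivCM 3 L (Matrix.diagonal α)).symm.toHomeomorph

end Family

end Literature.NumberTheory.Automorphic.UnitaryGroup

end
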